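import Literature.NumberTheory.GelbartRogawski1991.Sec1Defs
import Literature.NumberTheory.GelbartRogawski1991.Sec2Defs
import HarnessLib

/-!
# Gelbart–Rogawski 1991, §4 «Shimura integral» — the INTERFACE: sections `F(g, s, ξ)` and the Eisenstein series `E(g, s, ξ)`,
# the Shimura integral `SH(φ, θ, ξ, s)` (DEFINED), its local factors `SH(φ_v, θ_v, ξ_v, s)` (DEFINED), the torus integral (4.3.2)
# and the right-hand side of (4.3.1) (DEFINED), and the §4.2 factorisation data, AS ONE POSITED DATUM `ShimuraIntegralData X D J`
# over ★ `GR91Spectrum`, the squad's `L`-datum ★ `Sec1Defs.EndoscopicLData` and the Fourier–Jacobi datum ★ `Sec2Defs.GR91RData`,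
# with `R(s)`, `c_S(s)` and the `L`-quotients of Theorem 4.3.1 DEFINED over it

Topic `NumberTheory/GelbartRogawski1991`; file `Sec4Defs.lean`, namespace `Literature.NumberTheory.GelbartRogawski1991.Sec4Defs`
(squad TG file map `T/GR/TG-plan/g0/SPLIT-v1.md` §2, import DAG of RULING 3 (c)), structure namespace `ShimuraIntegralData`.  This file
states NO numbered item: it is the interface imported by `Sec4.lean` (§4.1 pole statements, Prop. 4.2.1, Thm. 4.3.1, (4.3.1), Prop. 4.3.2,
(5.1.2)).  Transcription discipline of ★ `WeilRepresentationsAPackets.lean` (`GR91Spectrum`), ★ `Sec1Defs` ∕ ★ `Sec2Defs` and of the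
squad-TR carpets (★ `Literature.NumberTheory.Rogawski1990.Ch13Sec5Defs`): ONE posited datum whose fields are TYPES and FUNCTIONS (the
carriers and the printed functions of §4 — "sockets"), every socket documented with the printed sentence it stands for and its locator;
the printed DEFINITIONS (the Shimura integral, its local factor, (4.3.2), (4.3.1), `R(s)`, `c_S(s)`) are definitions WITH BODIES over the
sockets; **no field asserting a proposition, no closed named fact, no proof, no `sorry`, no instance, no notation**.  NO SECOND CARRIER:
places, `ξ ↦ ξ_F`, `ξ ↦ ξ¹`, `ω_{E/F}`, every `L`-function and «cuspidal» are ★ `EndoscopicLData` (`D`); `G(𝔸)`, `V_π`, `R(𝔸)`, `B(F)`,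
`R^∧`, `Λ(π)`, `τ ↦ τ ⊗ ν` are ★ `GR91RData` (`J`).  A consumer supplies the data from its own model and takes the `Sec4` predicates
`(h : Sec4.thm431 A)` as explicit hypotheses.  Carpet-typing squad TG «GelbartRogawski1991» (cell `hodgecm-mathlib`, seat TG-t02).
HONEST LABEL: nothing here proves anything; HC_CM is proved only modulo the 7 printed citations (2 remaining: hLiu418 =
stmt-HodgeConjecture-24832, h413 = stmt-HodgeConjecture-24833) until rung 0 closes.

## Source and what was read

S. Gelbart, J. Rogawski, *L-functions and Fourier–Jacobi coefficients for the unitary group `U(3)`*, Invent. Math. **105** (1991)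
445–472 [GelbartRogawski1991], §4 «Shimura integral», printed pp. 462–465, with p. 460 L18 – p. 461 L3 and the Remark p. 461 (the
parametrisation `τ(γ, ψ, χ)`, `ω(τ)` that §4.2 reads) and the first lines of the proof of Theorem 5.1.1 (p. 465 L31–34, p. 466 L1–2).
The article is NOT in the lit store (`lit read GelbartRogawski1991` = not held; acq-07579 cite-only; the store key
`paper:galaxy-pdf-5389841351652646400` is a DIFFERENT article of the same volume); it is HELD as the GDZ page images
`img_p445.jpg … img_p472.jpg` (Göttingen PPN356556735_0105) kept by the cell at
`run/shared/lean/pub/pub-hodgecm/pub-hodgecm-cf-rogawski-g6/lit/GR91-invent105/`, and every quotation below was read on those IMAGES by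
this seat (the OCR files `pNNN.txt` next to them garble all formulas and were used only to locate).  Locator «p. N Lk» = printed page `N`,
`k`-th line of the page body (running head excluded, every displayed formula counted as one line; ±1).

GENERALITY (§1.1, p. 449, governs everything): `E/F` a quadratic extension of NUMBER FIELDS, `G` = THE QUASI-SPLIT `U(3)` of the
skew-Hermitian form `Φ = antidiag(1, ξ, −1)`, `B = MN` its upper-triangular Borel subgroup, `N` the Heisenberg unipotent radical, `U` the
centre of `N`, `R` the centralizer of `U` in `B` («`R = Z S′ N`, where `S′ = {d(1, β, 1) : β ∈ E¹}`», p. 460 L23), `K = ∏ K_v` (p. 454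
L38–39: «`K_v` the subgroup of integral points in `G_v`»), `ψ` a fixed non-trivial character of `F\𝔸`.  `Ω` = the set of Weil
representations `ω(γ, ψ, χ)` (§3.4, p. 460) = the range of ★ `GR91Spectrum.weil`.

PRINTED SLIP, p. 462 L18–19: «4.2 Let `ω` be a cuspidal representation of `G`. Let `π ∈ Ω`. If `θ` is a theta series in `V_ω` and
`φ ∈ V_π`, we define the Shimura integral …».  Everything that follows uses the OPPOSITE roles — `φ ∈ V_π` is the rapidly decreasing
(cusp) form and `π` carries `Λ(π)` and `L_S(s + ½, π ⊗ ξ)` (p. 462 L21–25, Thm. 4.3.1, and §5.1 p. 465 L32: «Suppose first that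
`π ∈ Π(ρ)` is cuspidal. Choosing data as in §4 …»), while `θ` is a theta series and `ω = ω(τ*) ∈ Ω` (p. 462 L26–27; §4.3 p. 464
L5–6: «By `γ` we denote the Hecke character of `E` such that `ω = ω(γ, ψ, χ)`»).  Per squad RULING 2 (G) ([sic] policy) the datum
and `Sec4` type the consistent reading **`π` cuspidal, `ω ∈ Ω`** and record the printed sentence verbatim [sic].

[§4.1, p. 462 L4–17] «*4.1 Eisenstein series.* Let `ξ` be a unitary Hecke character of `E`. We regard `ξ` as a character of
`B(F)\B(𝔸)` by setting `ξ(d(α, β, ᾱ⁻¹)n) = ξ(α)` for `n ∈ N(𝔸)`. Set `α(d(α, β, ᾱ⁻¹)n) = ‖α‖`. Let `F = ∏ F_v` be a smooth function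
on `K` such that `F(bk) = ξ(b)F(k)` for `b ∈ K ∩ B(𝔸)` and for `s ∈ ℂ`, set `F(g, s, ξ) = α(b)^{s+1} ξ(b) F(k)`. The Eisenstein series
`E(g, s, ξ) = Σ_{γ ∈ B(F)\G(F)} F(γg, s, ξ)` converges for `Re(s) ≫ 0` and has a meromorphic continuation to the complex `s`-plane. The
possible poles of `E(g, s, ξ)` are well- known. Set `R(s) = L(2s, ξ_F ω_{E/F}) L(s, ξ) / (L(2s + 1, ξ_F ω_{E/F}) L(s + 1, ξ))` where
`ξ_F` denotes the restriction of `ξ` to `F`. The set of poles of `E(g, s, ξ)` is contained in the set of poles of `R(s)` ([HC, Thm. 7,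
p. 105]). In particular, for `Re(s) > 0`, the possibilities are (1) `s = 1`, `ξ` trivial, (2) `s = ½`, `ξ_F = ω_{E/F}`, `L(½, ξ) ≠ 0`.»
([HC] = Harish-Chandra, *Automorphic forms on semisimple Lie groups*, LNM 62 (1968) [HarishChandra1968], reference list p. 471; not held,
not re-read.)
[§4.2, p. 462 L18–35, p. 463 L1–9] the slip quoted above; «we define the Shimura integral
`SH(φ, θ, ξ, s) = ∫_{G(F)\G(𝔸)} φ(g) θ(g)‾ E(g, s, ξ) dg`. The absolute and uniform convergence in compact subsets of this integral is
clear from the rapid decrease of `φ` and the slow increase of `θ(g)E(g, s, ξ)`. Suppose that `τ ∈ Λ(π)`, where we recall that `Λ(π)`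
is the set of `τ` such that `φ_τ` is non-zero for some `φ ∈ V_π`. Factor the `R(𝔸)`-map `L : π → τ`, `φ → φ_τ|R(𝔸)`, as a product
`∏ L_v` as in the proof of Theorem 2.4.1, where `L_v : π_v → τ_v`. Set `τ* = τ ⊗ ξ_R`, where `ξ_R` is the restriction of `ξ` to
`R(𝔸)`, and assume that `ω = ω(τ*)`. Assume that `φ` and `θ` correspond to decomposible [sic] elements `x = ⊗x_v` and `w = ⊗w_v` with
respect to decompositions `π = ⊗π_v` and `ω = ⊗ω_v`, and define the local Fourier coefficients: `φ_v(g) = L_v(π_v(g)x_v)`,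
`θ_v(g) = L*_v(ω_v(g)w_v)`, where `L* = ∏ L*_v` is the `R(𝔸)`-map `ω(τ*) → τ*`. let [sic] `⟨,⟩_v` be a non-zero Hermitian inner
product on `τ_v`, which we view as a Hermitian `ξ_{Rv}`-pairing between `τ_v` and `τ*_v` : `⟨τ(r)w, τ*(r)w*⟩_v = ξ_R(r)⁻¹⟨w, w*⟩_v`.
Then `⟨,⟩_v` is unique up to multiples. Let `S` be a finite set of places of `F`, including the archimedean places, such that `π_v`,
`ω_v`, `τ_v`, `ξ_v` and `ψ_v` are unramified for `v ∉ S`. We also assume that `F_v` is the characteristic function of `K_v` for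
`v ∉ S`. As in the proof of Theorem 2.4.1, let `{y⁰_v}_{v ∉ S}` be a collection of vectors in `τ_v` and assume that `⟨y⁰_v, y⁰_v⟩_v = 1`.
We can then assume `L_v(x_v) = L*_v(w_v) = y⁰_v` for almost all `v`. Note also that the integral on the left below,
`∫_{R(F)\R(𝔸)} φ_τ(r) θ*_τ(r)‾ ξ_R(r) dr = ∏_v ⟨L_v(x_v), L*_v(w_v)⟩_v`, defines a `ξ_R`-pairing between `τ` and `τ*`. Since such a
pairing is unique up to multiples, we can assume the local pairings `⟨,⟩_v` for `v ∈ S` chosen so that the above equality holds (with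
almost all terms in the product on the right equal to one).»  («`ξ_R`»: on `R(𝔸) = Z(𝔸)S′(𝔸)N(𝔸)` the character
`d(α, β, ᾱ⁻¹)n ↦ ξ(α)` is `z s′ n ↦ ξ(z) = ξ¹(z)`, `z ∈ Z(𝔸) ≅ 𝔸¹_E`; in the coordinates «`ν(zs′n) = ν₁(z)ν₂(s′)`» of p. 460 L31 it is
the pair `(ξ¹, 1)`, so `τ* = τ ⊗ ξ_R` = ★ `GR91RData.twist (ξ¹, 1) τ` with `ξ¹` = ★ `EndoscopicLData.res1 ξ`.)
[Prop. 4.2.1, p. 463 L10–12] the local integral «`SH(φ_v, θ_v, ξ_v, s) = ∫_{R_v\G_v} ⟨φ_v(g), θ_v(g)⟩_v F_v(g, s, ξ) dg`».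
[§4.3, p. 464 L5–24] «By `γ` we denote the Hecke character of `E` such that `ω = ω(γ, ψ, χ)`»; Thm. 4.3.1 «`c_S(s) =
c ∏_{v ∈ S} SH(φ_v, θ_v, ξ_v γ_v, s)`»; proof: «We have `dg = α(m)⁻² dm dn dk`. For `v ∉ S`, the integral over `R_v\G_v` reduces to
`SH(φ_v, θ_v, ξ_v γ_v, s) = meas(K_v) ∫_{S_v\M_v} ⟨φ_v(m), θ_v(m)⟩_v α_v(m)^{s−1} ξ_v(m) γ_v(m) d_v m`»; (4.3.1)
«`∫_{K_v} [∫_{S_v\M_v} ⟨φ_v(mk), θ_v(mk)⟩_v α_v(m)^{s−1} ξ_v(m) γ_v(m) dm] F_v(k) dk`»; (4.3.2) «`∫_{S_v\M_v} ⟨φ_v(m), θ_v(m)⟩_v α_v(m)^{s−1}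
ξ_v(m) γ_v(m) dm`»; p. 465 L7–8 «`F_v(k)` may be an arbitrary smooth function on `K_v` subject to the condition `F_v(bk) = ξ(b)F_v(k)` for
`b ∈ B_v ∩ K_v`».
[Remark, p. 461 L36–37] «For `τ = τ(γ, ψ, χ) ∈ R^∧`, set `ω(τ) = ω(γ, ψ, χ)`. Then the map `τ → ω(τ)` induces a bijection between
`B(F)\R^∧` and `Ω`.»

## What is typed

* `ShimuraIntegralData X D J` (§1) — the datum, over `X : GR91Spectrum` (quasi-split `U(3)`), `D : EndoscopicLData X HeckeE HeckeF`
  (places, characters, `L`-functions, «cuspidal») and `J : GR91RData X GA` (`G(𝔸) = GA` a group from context, `V_π = J.form π`,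
  `R(𝔸) = J.R`, `R^∧`, `Λ(π) = J.Lambda π`, `τ ⊗ ν = J.twist ν τ`).
* DEFINED over it (§2): `BFmodGF` (`B(F)\G(F)` as the right-coset space of ★ `J.B ⊓ J.GF` in `J.GF`), `eisTerm` (`F(γg, s, ξ)`), `R`
  (the ratio `R(s)` of §4.1 in ★ `D.LF`, `D.LHecke`), `EisPoleAt` ∕ `EisHolomorphicAt` (Mathlib `meromorphicOrderAt` ∕ `AnalyticAt` of
  `s ↦ E(g, s, ξ)`), `SH` (THE SHIMURA INTEGRAL, over the posited functional `∫_{G(F)\G(𝔸)}`), `SHv` (its local factor, Prop. 4.2.1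
  display), `integral432` ((4.3.2)), `rhs431` ((4.3.1)), `cS` (`c_S(s)`), `lQuotS` ∕ `lQuotv` (the partial and local `L`-quotients of
  Thm. 4.3.1 in ★ `D.LstdS`, `D.LFS`, `D.LHeckeS` ∕ ★ `D.Lstdv`, `D.LFv`, `D.LHeckev`).
* NO §3 socket: «`ω = ω(τ*)`» (p. 462 L27) is phrased in `Sec4.lean` through `Sec3ThetaDefs.GR91ThetaData.weilOfR` (`τ ↦ ω(τ)`,
  Remark p. 461; seat TG-t08) and the theta series `θ ∈ Θ(γ, ψ, χ)` through `GR91ThetaData.ThetaChi`, both imported THERE, so that this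
  interface depends on ★ `Sec1Defs` and ★ `Sec2Defs` only (squad RULING 3 (c)).
NOT typed here: any numbered statement (→ `Sec4.lean`); the measures themselves (the integrals `∫_{G(F)\G(𝔸)}`, `∫_{R_v\G_v}`,
`∫_{S_v\M_v}`, `∫_{K_v}` are posited linear functionals on functions, as ★ `GR91RData.intU` ∕ `intN` are); §2 and §3.3–3.4 beyond what
★ `GR91RData` provides; any proof.
-/

noncomputable section

open scoped BigOperators

namespace Literature.NumberTheory.GelbartRogawski1991.Sec4Defs

open Literature.NumberTheory.GelbartRogawski1991.Sec1Defs
open Literature.NumberTheory.GelbartRogawski1991.Sec2Defs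

universe u

/-! ## §1 The datum -/

/-- **`ShimuraIntegralData X D J`** — the posited DATUM of [GelbartRogawski1991] §4 over the ★ spectrum `X : GR91Spectrum` of the
quasi-split `U(3)` of `E/F`, the squad's `L`-datum `D : EndoscopicLData X HeckeE HeckeF` (★ `Sec1Defs`: places, `ξ_F`, `ξ¹`, `ω_{E/F}`,
`L`-functions, «cuspidal») and the Fourier–Jacobi datum `J : GR91RData X GA` (★ `Sec2Defs`: `G(𝔸)`, `V_π`, `R(𝔸)`, `B(F)`, `R^∧`,
`Λ(π)`, twists): the invariant integral `∫_{G(F)\G(𝔸)}`; the sections `F = ∏ F_v` with `F(g, s, ξ)` and the (continued) Eisenstein series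
`E(g, s, ξ)`; the admissible exceptional sets `S`; the local data `(x_v, w_v, L_v, L*_v, ⟨,⟩_v, F_v)` of §4.2 with the
relation «is a factorisation of `(φ, θ, F)`»; and, at each place `v`, the carriers `G_v ⊇ M_v`, `K_v`, the invariant integrals
`∫_{R_v\G_v}`, `∫_{S_v\M_v}`, `∫_{K_v}`, `meas(K_v)`, `α_v`, `ξ_v` on `M_v`, the local Fourier-coefficient pairing
`g ↦ ⟨φ_v(g), θ_v(g)⟩_v`, the local section `F_v(g, s, ξ)` and the `K_v`-translation of local data.  Nothing is asserted by the structure;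
every field's docstring gives the printed object it stands for.  PRINTED SLIP recorded [sic]: p. 462 L18 «Let `ω` be a cuspidal
representation of `G`. Let `π ∈ Ω`.» — the rest of §4 and §5.1 use `π` cuspidal (`φ ∈ V_π` a cusp form, `Λ(π)`, `L_S(s + ½, π ⊗ ξ)`)
and `ω = ω(τ*) = ω(γ, ψ, χ) ∈ Ω` (`θ ∈ V_ω` a theta series), and so do this datum and `Sec4` (RULING 2 (G)).
[cite: GelbartRogawski1991, §4.1–§4.3 (pp. 462–465)] -/
structure ShimuraIntegralData (X : GR91Spectrum.{u}) {HeckeE HeckeF : Type u} [CommGroup HeckeE] [CommGroup HeckeF]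
    (D : EndoscopicLData X HeckeE HeckeF) {GA : Type u} [Group GA] (J : GR91RData X GA) : Type (u + 1) where
  /-- `f ↦ ∫_{G(F)\G(𝔸)} f(g) dg` for left `G(F)`-invariant `f` on `G(𝔸)` (the invariant integral of the Shimura integral; cf.
  ★ `GR91RData.intU`, `intN`) [§4.2 (p. 462 L20)] -/
  intG : (GA → ℂ) → ℂ
  /-- the sections for `ξ`: «Let `F = ∏ F_v` be a smooth function on `K` such that `F(bk) = ξ(b)F(k)` for `b ∈ K ∩ B(𝔸)`»
  [§4.1 (p. 462 L6–7)] -/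
  Sect : HeckeE → Type u
  /-- `(F, g, s) ↦ F(g, s, ξ)`: «for `s ∈ ℂ`, set `F(g, s, ξ) = α(b)^{s+1} ξ(b) F(k)`» (`g = bk`, `α(d(α, β, ᾱ⁻¹)n) = ‖α‖`,
  `ξ(d(α, β, ᾱ⁻¹)n) = ξ(α)`) [§4.1 (p. 462 L5–7)] -/
  sectFn : ∀ {ξ : HeckeE}, Sect ξ → GA → ℂ → ℂ
  /-- `E(g, s, ξ)`: the Eisenstein series `Σ_{γ ∈ B(F)\G(F)} F(γg, s, ξ)` for `Re(s) ≫ 0`, meromorphically continued in `s` (an arbitrary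
  value at its poles) [§4.1 (p. 462 L8–11)] -/
  eis : ∀ {ξ : HeckeE}, Sect ξ → GA → ℂ → ℂ
  /-- `GoodS π ω τ ξ ψ S`: «Let `S` be a finite set of places of `F`, including the archimedean places, such that `π_v`, `ω_v`, `τ_v`,
  `ξ_v` and `ψ_v` are unramified for `v ∉ S`» (archimedean = `¬ D.IsFinitePlace v`) [§4.2 (p. 462 L34–35)] -/
  GoodS : X.Rep → X.Rep → Submodule ℂ (J.R → ℂ) → HeckeE → X.AddChar → Finset D.Place → Prop
  /-- `LocDatum v π ω τ ξ`: the local data at `v` of §4.2 for `(π_v, ω_v, τ_v, ξ_v)` — a vector `x_v ∈ π_v`, a vector `w_v ∈ ω_v`, the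
  local maps `L_v : π_v → τ_v`, `L*_v : ω_v → τ*_v`, a non-zero Hermitian `ξ_{Rv}`-pairing `⟨,⟩_v` («unique up to multiples») and a
  smooth `F_v` on `K_v` with `F_v(bk) = ξ(b)F_v(k)` for `b ∈ B_v ∩ K_v` (p. 465 L7–8) [§4.2 (p. 462 L24–33)] -/
  LocDatum : D.Place → X.Rep → X.Rep → Submodule ℂ (J.R → ℂ) → HeckeE → Type u
  /-- `IsFactorisation φ θ F τ S ℓ`: the family `ℓ = (ℓ_v)_v` of local data IS a factorisation of `(φ, θ, F)` through `τ` with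
  exceptional set `S`, exactly as on p. 462 L24 – p. 463 L9: `L = ∏ L_v`, `L* = ∏ L*_v`; «`φ` and `θ` correspond to decomposible
  elements `x = ⊗x_v` and `w = ⊗w_v`» of `π = ⊗π_v`, `ω = ⊗ω_v`; `F = ∏ F_v`; `S` as in `GoodS`; «`F_v` is the characteristic function
  of `K_v` for `v ∉ S`»; «`L_v(x_v) = L*_v(w_v) = y⁰_v`», `⟨y⁰_v, y⁰_v⟩_v = 1`, outside `S`; and the pairings at `v ∈ S` normalised by
  «`∫_{R(F)\R(𝔸)} φ_τ(r) θ*_τ(r)‾ ξ_R(r) dr = ∏_v ⟨L_v(x_v), L*_v(w_v)⟩_v`» [§4.2 (p. 462 L24 – p. 463 L9)] -/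
  IsFactorisation : ∀ {π ω : X.Rep} {ξ : HeckeE}, (GA → ℂ) → (GA → ℂ) → Sect ξ → (τ : Submodule ℂ (J.R → ℂ)) →
    Finset D.Place → (∀ v : D.Place, LocDatum v π ω τ ξ) → Prop
  /-- `G_v` [Prop. 4.2.1 (p. 463 L12): the domain `R_v\G_v`] -/
  Gv : D.Place → Type u
  /-- `M_v`, the diagonal subgroup `{d(α, β, ᾱ⁻¹)}` at `v` (§1.1), carrying the quotient `S_v\M_v` of (4.3.2) (the group `S` is not
  spelled out in §4; reading: `S = Z S′ = M ∩ R` with `S′ = {d(1, β, 1) : β ∈ E¹}` of p. 460 L23, so that `S_v\M_v ≅ E_v^×/E_v^1` via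
  `d(α, β, ᾱ⁻¹) ↦ α`) [proof of Thm. 4.3.1 (p. 464 L12); (4.3.2) (p. 464 L23)] -/
  Mv : D.Place → Type u
  /-- `K_v` («the subgroup of integral points in `G_v`», p. 454 L38–39), domain of the outer integral of (4.3.1) [(4.3.1) (p. 464 L20)] -/
  Kv : D.Place → Type u
  /-- `M_v ⊆ G_v` -/
  mToG : ∀ {v : D.Place}, Mv v → Gv v
  /-- `K_v ⊆ G_v` -/
  kToG : ∀ {v : D.Place}, Kv v → Gv v
  /-- `f ↦ ∫_{R_v\G_v} f(g) dg` (left `R_v`-(`ξ_R`-)invariant integrands) [Prop. 4.2.1 (p. 463 L12)] -/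
  intRG : ∀ {v : D.Place}, (Gv v → ℂ) → ℂ
  /-- `f ↦ ∫_{S_v\M_v} f(m) d_v m` [proof of Thm. 4.3.1 (p. 464 L12); (4.3.2) (p. 464 L23)] -/
  intSM : ∀ {v : D.Place}, (Mv v → ℂ) → ℂ
  /-- `f ↦ ∫_{K_v} f(k) dk` [(4.3.1) (p. 464 L20); «`dg = α(m)⁻² dm dn dk`» (p. 464 L10)] -/
  intK : ∀ {v : D.Place}, (Kv v → ℂ) → ℂ
  /-- `meas(K_v)` [proof of Thm. 4.3.1 (p. 464 L12)] -/
  measK : D.Place → ℝ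
  /-- `m ↦ α_v(m)`, `α(d(α, β, ᾱ⁻¹)n) = ‖α‖` at `v` [§4.1 (p. 462 L5–6); (4.3.2) (p. 464 L23)] -/
  alphaV : ∀ {v : D.Place}, Mv v → ℝ
  /-- `(ξ, m) ↦ ξ_v(m) = ξ_v(α)` for `m = d(α, β, ᾱ⁻¹) ∈ M_v` (so `(ξγ)_v(m) = ξ_v(m) γ_v(m)`) [§4.1 (p. 462 L5); (4.3.2) (p. 464 L23)] -/
  heckeLoc : ∀ {v : D.Place}, HeckeE → Mv v → ℂ
  /-- `g ↦ ⟨φ_v(g), θ_v(g)⟩_v`, the pairing of the local Fourier coefficients `φ_v(g) = L_v(π_v(g)x_v)`, `θ_v(g) = L*_v(ω_v(g)w_v)` of the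
  local datum [§4.2 (p. 462 L29–33); Prop. 4.2.1 (p. 463 L12)] -/
  pairFC : ∀ {v : D.Place} {π ω : X.Rep} {τ : Submodule ℂ (J.R → ℂ)} {ξ : HeckeE}, LocDatum v π ω τ ξ → Gv v → ℂ
  /-- `(g, s) ↦ F_v(g, s, ξ)`, the local section of the local datum extended by `α(b)^{s+1} ξ(b)` (so `F_v(k, s, ξ) = F_v(k)` on `K_v`)
  [§4.1 (p. 462 L6–7); Prop. 4.2.1 (p. 463 L12)] -/
  sectLoc : ∀ {v : D.Place} {π ω : X.Rep} {τ : Submodule ℂ (J.R → ℂ)} {ξ : HeckeE}, LocDatum v π ω τ ξ → Gv v → ℂ → ℂ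
  /-- `k · ℓ_v`: the local datum with `x_v`, `w_v` replaced by `π_v(k)x_v`, `ω_v(k)w_v` (so that its Fourier coefficients are
  `m ↦ φ_v(mk)`, `θ_v(mk)`), everything else unchanged [(4.3.1) (p. 464 L20): the inner integrand `⟨φ_v(mk), θ_v(mk)⟩_v`] -/
  actK : ∀ {v : D.Place} {π ω : X.Rep} {τ : Submodule ℂ (J.R → ℂ)} {ξ : HeckeE},
    Kv v → LocDatum v π ω τ ξ → LocDatum v π ω τ ξ

variable {X : GR91Spectrum.{u}} {HeckeE HeckeF : Type u} [CommGroup HeckeE] [CommGroup HeckeF] {GA : Type u} [Group GA]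

/-! ## §2 Defined objects

§2a — over ★ `EndoscopicLData` ∕ ★ `GR91RData` alone (`B(F)\G(F)`, `R(s)`, the `L`-quotients); §2b — over the datum `A`. -/

/-- **`B(F)\G(F)`** — the right cosets of `B(F) = B(𝔸) ∩ G(F)` (★ `J.B ⊓ J.GF`, as a subgroup of ★ `J.GF`) in `G(F)`, the index set
of the Eisenstein sum. [cite: GelbartRogawski1991, §4.1 (p. 462 L9)] -/
def BFmodGF (J : GR91RData X GA) : Type u :=
  Quotient (QuotientGroup.rightRel (J.B.subgroupOf J.GF))

/-- **`R(s)`** — «`R(s) = L(2s, ξ_F ω_{E/F}) L(s, ξ) / (L(2s + 1, ξ_F ω_{E/F}) L(s + 1, ξ))` where `ξ_F` denotes the restriction of `ξ`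
to `F`» (★ `D.LF` at `D.resF ξ * D.omegaEF`, ★ `D.LHecke` = `L_E(s, ξ)`; Lean's `x / 0 = 0` is the documented junk value where a
denominator vanishes). [cite: GelbartRogawski1991, §4.1 (p. 462 L12–13)] -/
def R (D : EndoscopicLData X HeckeE HeckeF) (ξ : HeckeE) : ℂ → ℂ := fun s =>
  D.LF (D.resF ξ * D.omegaEF) (2 * s) * D.LHecke ξ s / (D.LF (D.resF ξ * D.omegaEF) (2 * s + 1) * D.LHecke ξ (s + 1))

/-- **The `L`-quotient of Theorem 4.3.1** — `s ↦ L_S(s + ½, π ⊗ ξ) / (L_S(2s + 1, ξ_F) L_S(s + 1, ξγ))` in ★ `D.LstdS`, `D.LFS` (at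
`ξ_F = D.resF ξ`), `D.LHeckeS` (at `ξγ = ξ * D.ofOmega γ`) (`x / 0 = 0` junk where a denominator vanishes).
[cite: GelbartRogawski1991, Thm. 4.3.1 (p. 464 L8); (5.1.2) (p. 465 L34)] -/
def lQuotS (D : EndoscopicLData X HeckeE HeckeF) (S : Finset D.Place) (π : X.Rep) (ξ : HeckeE) (γ : X.OmegaHecke) : ℂ → ℂ :=
  fun s => D.LstdS S π ξ (s + 1 / 2) / (D.LFS S (D.resF ξ) (2 * s + 1) * D.LHeckeS S (ξ * D.ofOmega γ) (s + 1))

/-- **The local `L`-quotient at `v ∉ S`** — `s ↦ L_v(s + ½, π ⊗ ξ) / (L_v(2s + 1, ξ_F) L_v(s + 1, ξγ))` in ★ `D.Lstdv`, `D.LFv`,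
`D.LHeckev` (`x / 0 = 0` junk where a denominator vanishes). [cite: GelbartRogawski1991, proof of Thm. 4.3.1 (p. 464 L15)] -/
def lQuotv (D : EndoscopicLData X HeckeE HeckeF) (v : D.Place) (π : X.Rep) (ξ : HeckeE) (γ : X.OmegaHecke) : ℂ → ℂ :=
  fun s => D.Lstdv v π ξ (s + 1 / 2) / (D.LFv v (D.resF ξ) (2 * s + 1) * D.LHeckev v (ξ * D.ofOmega γ) (s + 1))

namespace ShimuraIntegralData

variable {D : EndoscopicLData X HeckeE HeckeF} {J : GR91RData X GA} (A : ShimuraIntegralData X D J)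

/-- **`F(γg, s, ξ)`** — the term of the Eisenstein sum at the coset `γ ∈ B(F)\G(F)`, computed on a representative (independent of the
representative in the intended model: `α` and `ξ` are trivial on `B(F)`). [cite: GelbartRogawski1991, §4.1 (p. 462 L7–9)] -/
def eisTerm {ξ : HeckeE} (F : A.Sect ξ) (γ : BFmodGF J) (g : GA) (s : ℂ) : ℂ :=
  A.sectFn F (((Quotient.out γ : J.GF) : GA) * g) s

/-- **«`E(g, s, ξ)` has a pole at `s₀`»** — for some `g ∈ G(𝔸)` the meromorphic function `s ↦ E(g, s, ξ)` has negative order at `s₀`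
(Mathlib `meromorphicOrderAt`; «The possible poles of `E(g, s, ξ)`», «The set of poles of `E(g, s, ξ)`»).
[cite: GelbartRogawski1991, §4.1 (p. 462 L10–14)] -/
def EisPoleAt {ξ : HeckeE} (F : A.Sect ξ) (s₀ : ℂ) : Prop :=
  ∃ g : GA, meromorphicOrderAt (fun s : ℂ => A.eis F g s) s₀ < 0

/-- **«`E(g, s, ξ)` is holomorphic at `s₀`»** — for every `g ∈ G(𝔸)`, `s ↦ E(g, s, ξ)` is analytic at `s₀` (used to phrase the
convergence sentence of §4.2). [cite: GelbartRogawski1991, §4.1 (p. 462 L10–11); §4.2 (p. 462 L21–22)] -/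
def EisHolomorphicAt {ξ : HeckeE} (F : A.Sect ξ) (s₀ : ℂ) : Prop :=
  ∀ g : GA, AnalyticAt ℂ (fun s : ℂ => A.eis F g s) s₀

/-- **THE SHIMURA INTEGRAL** — «we define the Shimura integral `SH(φ, θ, ξ, s) = ∫_{G(F)\G(𝔸)} φ(g) θ(g)‾ E(g, s, ξ) dg`» for
`φ ∈ V_π` (a cusp form), `θ ∈ V_ω` (a theta series) and the Eisenstein series of the section `F` for `ξ`, over the posited invariant
integral (its value in `s` is meaningful where the integral converges and, continued, beyond; roles `π` cuspidal ∕ `ω ∈ Ω` per the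
recorded slip). [cite: GelbartRogawski1991, §4.2 (p. 462 L18–22)] -/
def SH {ξ : HeckeE} (φ θ : GA → ℂ) (F : A.Sect ξ) (s : ℂ) : ℂ :=
  A.intG (fun g => φ g * (starRingEnd ℂ) (θ g) * A.eis F g s)

/-- **The local Shimura integral** — «`SH(φ_v, θ_v, ξ_v, s) = ∫_{R_v\G_v} ⟨φ_v(g), θ_v(g)⟩_v F_v(g, s, ξ) dg`» of a local datum `ℓ_v`
(value meaningful where the integral converges and, continued, beyond). [cite: GelbartRogawski1991, Prop. 4.2.1 (p. 463 L12)] -/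
def SHv {v : D.Place} {π ω : X.Rep} {τ : Submodule ℂ (J.R → ℂ)} {ξ : HeckeE} (ℓ : A.LocDatum v π ω τ ξ) (s : ℂ) : ℂ :=
  A.intRG (fun g => A.pairFC ℓ g * A.sectLoc ℓ g s)

/-- **(4.3.2)** — «`∫_{S_v\M_v} ⟨φ_v(m), θ_v(m)⟩_v α_v(m)^{s−1} ξ_v(m) γ_v(m) dm`» for the local datum `ℓ_v` and ITS character (printed
for the character `ξγ`, whose value at `m` is `ξ_v(m)γ_v(m)`; `α_v(m)^{s−1}` is the principal complex power of the positive real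
`α_v(m)`). [cite: GelbartRogawski1991, (4.3.2) (p. 464 L23); proof of Thm. 4.3.1 (p. 464 L12)] -/
def integral432 {v : D.Place} {π ω : X.Rep} {τ : Submodule ℂ (J.R → ℂ)} {ξ : HeckeE} (ℓ : A.LocDatum v π ω τ ξ) (s : ℂ) : ℂ :=
  A.intSM (fun m => A.pairFC ℓ (A.mToG m) * ((A.alphaV m : ℂ) ^ (s - 1)) * A.heckeLoc ξ m)

/-- **The right-hand side of (4.3.1)** — «`∫_{K_v} [∫_{S_v\M_v} ⟨φ_v(mk), θ_v(mk)⟩_v α_v(m)^{s−1} ξ_v(m) γ_v(m) dm] F_v(k) dk`»: the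
`K_v`-integral against `F_v(k) dk` of the torus integral (4.3.2) of the `k`-translated local datum (`F_v(k) = F_v(k, s, ξ)`).
[cite: GelbartRogawski1991, (4.3.1) (p. 464 L20)] -/
def rhs431 {v : D.Place} {π ω : X.Rep} {τ : Submodule ℂ (J.R → ℂ)} {ξ : HeckeE} (ℓ : A.LocDatum v π ω τ ξ) (s : ℂ) : ℂ :=
  A.intK (fun k => A.integral432 (A.actK k ℓ) s * A.sectLoc ℓ (A.kToG k) s)

/-- **`c_S(s)`** — «`c_S(s) = c ∏_{v ∈ S} SH(φ_v, θ_v, ξ_v γ_v, s)`»: the constant `c` times the product over `S` of the local Shimura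
integrals of the local data `ℓ_v`. [cite: GelbartRogawski1991, Thm. 4.3.1 (p. 464 L9)] -/
def cS {π ω : X.Rep} {τ : Submodule ℂ (J.R → ℂ)} {ξ : HeckeE} (c : ℂ) (S : Finset D.Place)
    (ℓ : ∀ v : D.Place, A.LocDatum v π ω τ ξ) : ℂ → ℂ :=
  fun s => c * ∏ v ∈ S, A.SHv (ℓ v) s

end ShimuraIntegralData

end Literature.NumberTheory.GelbartRogawski1991.Sec4Defs

end
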